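import Summits.HodgeConjecture.HodgeConjecture.Theorems.MarkmanPartnerTransportIsometrySpannedThirdSelfAdjointScalar
import Summits.HodgeConjecture.HodgeConjecture.Theses.MarkmanPartnerTransport

/-!
# Route MarkmanPartnerTransport · target `K3Sq2TypeHodge` (stmt-HodgeConjecture-19649) — what is LEFT of the
# target after the partner-free self-adjoint-scalar theorem: only fourfolds with a NON-SCALAR self-adjoint
# rational Hodge endomorphism of `T(X)` (`E₀ ≠ ℚ`: real multiplication, or CM by a field of degree `≥ 4`)

`hodgeConjectureFor_of_selfAdjointEndomorphisms_scalar` (`…IsometrySpannedThirdSelfAdjointScalar`) proves HC⁴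
for every marked smooth projective `K3^{[2]}`-type fourfold all of whose `q`-self-adjoint rational Hodge
endomorphisms of `H²` killing `N¹(X)` with transcendental image are rational scalars on `T(X)`, at every Picard
rank and without a K3 partner. Hence the route's target `K3Sq2TypeHodge` — HC⁴ for ALL marked smooth projective
`K3^{[2]}`-type fourfolds — is implied by HC⁴ for those carrying such an endomorphism which is NOT a rational
scalar on `T(X)`; by Zarhin these are exactly the fourfolds whose endomorphism field `E = End_Hdg T(X)_ℚ` has
maximal totally real subfield `E₀ ≠ ℚ` (real multiplication, or CM with `[E : ℚ] ≥ 4`). Modulo the three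
published facts {`VerbitskyGuan_cohomology_K3HilbertSquareType`, `OGrady2008_dualBBFClass_algebraic`,
`Voisin2003_cupProduct_algebraicClasses`}; no Markman, no period surjectivity, no Picard-rank hypothesis.

* `k3Sq2TypeHodge_of_nonScalarSelfAdjoint` — the reduction, concluding the route's target decl BY NAME.

No definition, no sorry. References: Yu. Zarhin, J. reine angew. Math. 341 (1983) Thm. 1.5.1; B. van Geemen,
Adv. Math. 219 (2008) (real multiplication on K3-type Hodge structures).
-/

noncomputable section

set_option linter.dupNamespace false

open Module CategoryTheory
open Literature.AlgebraicTopology.SingularHomology Literature.Geometry.Kaehler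
open Literature.AlgebraicGeometry Literature.AlgebraicGeometry.Motives Literature.AlgebraicGeometry.HodgeTheory
open Literature.AlgebraicGeometry.Hyperkaehler Literature.AlgebraicGeometry.Surfaces
open Summit.HodgeConjecture.HodgeConjecture.Theorems.NikulinTwinTransport
open Summit.HodgeConjecture.HodgeConjecture.Theorems.MarkmanPartnerTransport.BBFPositivity

namespace Summit.HodgeConjecture.HodgeConjecture.Theorems.MarkmanPartnerTransport.PartnerLattice

/-- `MarkedK3Sq[X, φ, P, z]`: VERBATIM the `let MarkedK3Sq := …` binder of the route declarations of
MarkmanPartnerTransport (clauses (m1)–(m6)). Local notation only. -/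
local notation3 (prettyPrint := false) "MarkedK3Sq[" X ", " φ ", " P ", " z "]" =>
  (((IsIntegralClass P ∧ ∀ Q : complexBetti X (2 * 4), IsIntegralClass Q → ∃ n : ℤ, Q = n • P) ∧
    (∀ c : complexBetti X 2, IsIntegralClass c ↔ ∃ v : K3HilbertIndex → ℤ, φ c = fun i => (v i : ℂ)) ∧
    (∀ a : complexBetti X 2, cupPowTwo a 4 = ((3 : ℂ) * (k3HilbertForm 2 (φ a) (φ a)) ^ 2) • P) ∧
    (IsOfHodgeType 4 X 2 2 0 (LinearEquiv.symm φ z) ∧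
      ∀ τ : complexBetti X 2, IsOfHodgeType 4 X 2 2 0 τ → ∃ t : ℂ, τ = t • LinearEquiv.symm φ z) ∧
    (∀ c : complexBetti X 2, IsOfHodgeType 4 X 2 1 1 c ↔
      (k3HilbertForm 2 (φ c) z = 0 ∧ k3HilbertForm 2 (φ c) (star z) = 0)) ∧
    (k3HilbertForm 2 z z = 0 ∧ 0 < (k3HilbertForm 2 (star z) z).re)))

/-- `Cup3[c, y, w] = (c ∪ y) ∪ w ∈ H⁸` for `c ∈ H⁴`, `y, w ∈ H²`. Local notation only. -/
local notation3 (prettyPrint := false) "Cup3[" c ", " y ", " w "]" =>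
  cupProduct (rfl : 2 * 3 + 2 = 2 * 4) (cupProduct (rfl : 2 * 2 + 2 = 2 * 3) c y) w

variable {X : SchemeOver ℂ} {φ : complexBetti X 2 ≃ₗ[ℂ] (K3HilbertIndex → ℂ)} {P : complexBetti X (2 * 4)}
  {z : K3HilbertIndex → ℂ}

/-- `hQXsa[X, φ]`: every `q`-SELF-ADJOINT rational Hodge endomorphism of `H²(X)` killing `N¹(X)` with
`q`-transcendental image is a rational scalar on `T(X)` (`E₀ = ℚ`). Local notation only. -/
local notation3 (prettyPrint := false) "hQXsa[" X ", " φ "]" =>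
  ∀ f : complexBetti X 2 →ₗ[ℂ] complexBetti X 2,
    (∀ y, IsRationalClass y → IsRationalClass (f y)) →
    (∀ (i j : ℕ) y, IsOfHodgeType 4 X 2 i j y → IsOfHodgeType 4 X 2 i j (f y)) →
    (∀ d : complexBetti X 2, d ∈ algebraicClasses X 1 → f d = 0) →
    (∀ y : complexBetti X 2, ∀ d : complexBetti X 2, d ∈ algebraicClasses X 1 →
      k3HilbertForm 2 (φ (f y)) (φ d) = 0) →
    (∀ y w : complexBetti X 2, k3HilbertForm 2 (φ (f y)) (φ w) = k3HilbertForm 2 (φ y) (φ (f w))) →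
    ∃ a : ℚ, ∀ y : complexBetti X 2,
      (∀ d : complexBetti X 2, d ∈ algebraicClasses X 1 → k3HilbertForm 2 (φ y) (φ d) = 0) →
      f y = (a : ℂ) • y

/-- **The route's target modulo its real-multiplication / higher-CM residue.** `K3Sq2TypeHodge` (HC⁴ for every
marked smooth projective `K3^{[2]}`-type fourfold) follows from HC⁴ for the marked fourfolds admitting a
`q`-self-adjoint rational Hodge endomorphism of `H²(X)` that kills `N¹(X)`, has transcendental image and is NOT
a rational scalar on `T(X)` (`E₀ ≠ ℚ`), modulo {Verbitsky–Guan, O'Grady, Voisin}: the complementary case is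
`hodgeConjectureFor_of_selfAdjointEndomorphisms_scalar`. [cite: Zarhin1983HodgeGroupsK3, Thm. 1.5.1]
[cite: Novario2026HodgeClassesHilbertSquares, Thm. 6.2] -/
theorem k3Sq2TypeHodge_of_nonScalarSelfAdjoint
    (hV : VerbitskyGuan_cohomology_K3HilbertSquareType) (hO : OGrady2008_dualBBFClass_algebraic)
    (hcup : Voisin2003_cupProduct_algebraicClasses)
    (hres : ∀ (X : SchemeOver ℂ), IsSmoothProjective 4 X → IsOfK3HilbertSquareType X →
      ∀ (φ : complexBetti X 2 ≃ₗ[ℂ] (K3HilbertIndex → ℂ)) (P : complexBetti X (2 * 4)) (z : K3HilbertIndex → ℂ),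
      MarkedK3Sq[X, φ, P, z] →
      ∀ f : complexBetti X 2 →ₗ[ℂ] complexBetti X 2,
        (∀ y, IsRationalClass y → IsRationalClass (f y)) →
        (∀ (i j : ℕ) y, IsOfHodgeType 4 X 2 i j y → IsOfHodgeType 4 X 2 i j (f y)) →
        (∀ d : complexBetti X 2, d ∈ algebraicClasses X 1 → f d = 0) →
        (∀ y : complexBetti X 2, ∀ d : complexBetti X 2, d ∈ algebraicClasses X 1 →
          k3HilbertForm 2 (φ (f y)) (φ d) = 0) →
        (∀ y w : complexBetti X 2, k3HilbertForm 2 (φ (f y)) (φ w) = k3HilbertForm 2 (φ y) (φ (f w))) →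
        (∀ a : ℚ, ∃ y : complexBetti X 2,
          (∀ d : complexBetti X 2, d ∈ algebraicClasses X 1 → k3HilbertForm 2 (φ y) (φ d) = 0) ∧
            f y ≠ (a : ℂ) • y) →
        HodgeConjectureFor 4 X) :
    Summit.HodgeConjecture.HodgeConjecture.Theses.MarkmanPartnerTransport.K3Sq2TypeHodge := by
  delta Summit.HodgeConjecture.HodgeConjecture.Theses.MarkmanPartnerTransport.K3Sq2TypeHodge
  intro _ X hX hK φ P z hM
  by_cases h : hQXsa[X, φ]
  · exact hodgeConjectureFor_of_selfAdjointEndomorphisms_scalar hV hO hcup hX hK hM h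
  · push Not at h
    obtain ⟨f, h1, h2, h3, h4, h5, hne⟩ := h
    exact hres X hX hK φ P z hM f h1 h2 h3 h4 h5 hne

end Summit.HodgeConjecture.HodgeConjecture.Theorems.MarkmanPartnerTransport.PartnerLattice

end
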